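import Summits.BirchSwinnertonDyer.BirchSwinnertonDyer.Theorems.GenusKolyvaginAtTwoGenusPrimitiveSupplyAtTwoKramerLocalIndices
import Summits.BirchSwinnertonDyer.BirchSwinnertonDyer.Theorems.GenusKolyvaginAtTwoGenusPrimitiveSupplyAtTwoDoorFieldParity
import HarnessLib

/-!
# Route `GenusKolyvaginAtTwo`, crux #2 `GenusPrimitiveSupplyAtTwo` (stmt-BirchSwinnertonDyer-22136):
# `d₂(W) + d₂(W^{(d_K)}) ≡ [d_K < 0] (mod 2)` for a quadratic field in which `2` and `N_W` split (Monsky 1996 §2 / Kramer 1981 Cor. 1)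

Width seat `bsd-line-gk2-p5` g19 (cell `bsd-f1-sign2`, SUPPLY lineage of crux 22136), file 57 of the series; sequel of `…KramerLocalIndices` (file 56).
THEOREMS ONLY (no definition, no named fact, no `sorry`); helper `--supports stmt-BirchSwinnertonDyer-22136`; no item is closed; BSD is not proved
by any of this.

* `exists_prod_card_roots_add_one_eq_two_pow` — `∏_{q ∣ d_K} #W(ℚ_q)[2] = 2^B` with `(−1)^B = J(Δ_min | |d_K|)` (Stickelberger prime by prime);
* `jacobiSym_minimalDiscriminantInt_natAbs_discr_eq` — `J(Δ_min | |d_K|) = sign Δ_min` if `d_K < 0`, `= 1` if `d_K > 0` (reciprocity; every odd prime of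
  `Δ_min` divides `N_W` and so is a residue of `d_K`, `d_K ≡ 1 (8)`);
* **`card_selmerGroup_add_twist_mod_two`** — `#Sel₂(W) = 2^s`, `#Sel₂(Wd) = 2^{s'}` (`Wd` any model of `W^{(d_K)}`) with **`s + s' ≡ [d_K < 0] (mod 2)`**:
  file 56's square `2^{s'+s} · 2^{[Δ>0 ∧ d_K<0]} · 2^B` forces `s + s' ≡ [Δ>0][d_K<0] + [Δ<0][d_K<0] = [d_K<0]`.

Next file: `+` Cassels–Tate (`exists_casselsTate_pairing_holds`) `+` corank base change ⟹ `Monsky1996_lemma14b_twoSelmerRank_parity_holds`.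

References: [Monsky1996] Lemma 1.4(b), §2; [Kramer1981] Thm. 1, Prop. 3, Cor. 1; [IrelandRosen1990] Prop. 5.2.2; [SilvermanAEC2009] III.1, X.4.2.
-/

set_option linter.dupNamespace false -- tree convention: `Summit.BirchSwinnertonDyer.BirchSwinnertonDyer.Theorems` (summit = sub-problem)
set_option autoImplicit false

noncomputable section

open scoped Classical ContRepresentation

namespace Summit.BirchSwinnertonDyer.BirchSwinnertonDyer.Theorems.GenusKolyArch

open WeierstrassCurve Field NumberField IsDedekindDomain Function
open Literature.NumberTheory.EllipticCurves Literature.NumberTheory.GaloisRepresentations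
open Rat.HeightOneSpectrum (primesEquiv natGenerator)

/-! ## §3 The sign of the genus budget and the parity `d₂(W) + d₂(W^{(d_K)}) ≡ [d_K < 0] (mod 2)` -/

section Parity

variable (W : WeierstrassCurve ℚ) [W.IsElliptic] [W.IsGloballyMinimal] (K : Type) [Field K] [NumberField K]

/-- **`∏_{q ∣ d_K} #W(ℚ_q)[2] = 2^B` with `(−1)^B = J(Δ_min(W) | |d_K|)`**: each factor `1 + #{roots of ψ mod q}` is `2^{i_q}` with
`(−1)^{i_q} = (Δ_min / q)` (Stickelberger, tree `neg_one_pow_padicValNat_card_roots_add_one_eq_jacobiSym`), and `|d_K|` is square-free (odd).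
[cite: Kramer1981, §2 Prop. 3] [cite: SilvermanAEC2009, III.1] -/
theorem exists_prod_card_roots_add_one_eq_two_pow (h2 : Module.finrank ℚ K = 2) (hH2 : SatisfiesHeegnerHypothesis 2 K)
    (hHN : SatisfiesHeegnerHypothesis (W.conductorNorm ℤ) K) :
    ∃ B : ℕ, ∏ q ∈ (NumberField.discr K).natAbs.primeFactors,
        ({x : ZMod q | 4 * x ^ 3 + ((integralModelInt W).b₂ : ZMod q) * x ^ 2 +
          2 * ((integralModelInt W).b₄ : ZMod q) * x + ((integralModelInt W).b₆ : ZMod q) = 0}.ncard + 1) = 2 ^ B ∧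
      (-1 : ℤ) ^ B = jacobiSym (minimalDiscriminantInt W) (NumberField.discr K).natAbs := by
  set d : ℤ := NumberField.discr K with hd_def
  have h8 : d % 8 = 1 := discr_emod_eight_of_two K h2 hH2
  have hodd : Odd d := Int.odd_iff.mpr (by omega)
  have hfact2 : Fact (Nat.Prime 2) := ⟨Nat.prime_two⟩
  -- per prime of `d_K`: odd, of good reduction
  have hq : ∀ q ∈ d.natAbs.primeFactors, q.Prime ∧ q ≠ 2 ∧ ¬ (q : ℤ) ∣ minimalDiscriminantInt W := by
    intro q hq
    obtain ⟨hqP, hqdvd, -⟩ := Nat.mem_primeFactors.mp hq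
    have hqd : (q : ℤ) ∣ d := Int.natCast_dvd.mpr hqdvd
    have hq2 : q ≠ 2 := by
      rintro rfl
      exact (Int.not_even_iff_odd.mpr hodd) (even_iff_two_dvd.mpr (by exact_mod_cast hqd))
    exact ⟨hqP, hq2, GenusExact.PlusDescent.not_dvd_minimalDiscriminantInt_of_dvd_discr_of_heegner W K h2 hHN hqP hq2 hqd⟩
  refine ⟨∑ q ∈ d.natAbs.primeFactors, padicValNat 2
      ({x : ZMod q | 4 * x ^ 3 + ((integralModelInt W).b₂ : ZMod q) * x ^ 2 +
        2 * ((integralModelInt W).b₄ : ZMod q) * x + ((integralModelInt W).b₆ : ZMod q) = 0}.ncard + 1), ?_, ?_⟩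
  · rw [← Finset.prod_pow_eq_pow_sum]
    refine Finset.prod_congr rfl fun q hq' ↦ ?_
    obtain ⟨hqP, hq2, hqΔ⟩ := hq q hq'
    haveI := Fact.mk hqP
    have h := GenusExact.PlusDescent.one_add_card_roots_eq_two_pow W hq2 hqΔ
    rw [Set.ncard_eq_toFinset_card', Set.toFinset_setOf, add_comm]
    exact h
  · rw [← Finset.prod_pow_eq_pow_sum, GenusExact.PlusDescent.jacobiSym_eq_prod_primeFactors _
      (GenusExact.PlusDescent.squarefree_natAbs_discr_of_odd h2 hodd)]
    refine Finset.prod_congr rfl fun q hq' ↦ ?_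
    obtain ⟨hqP, hq2, hqΔ⟩ := hq q hq'
    haveI := Fact.mk hqP
    exact GenusExact.PlusDescent.neg_one_pow_padicValNat_card_roots_add_one_eq_jacobiSym W hq2 hqΔ

/-- **Reciprocity: `J(Δ_min(W) | |d_K|) = sign Δ_min` if `d_K < 0`, `= 1` if `d_K > 0`**, for `K` quadratic with `2` and every prime of `N_W`
split (every odd prime of `Δ_min` divides `N_W`, hence is a residue of `d_K`; `d_K ≡ 1 (8)`). [cite: IrelandRosen1990, Prop. 5.2.2]
[cite: Kramer1981, §2 Cor. 1] -/
theorem jacobiSym_minimalDiscriminantInt_natAbs_discr_eq (h2 : Module.finrank ℚ K = 2) (hH2 : SatisfiesHeegnerHypothesis 2 K)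
    (hHN : SatisfiesHeegnerHypothesis (W.conductorNorm ℤ) K) :
    jacobiSym (minimalDiscriminantInt W) (NumberField.discr K).natAbs =
      if NumberField.discr K < 0 then (minimalDiscriminantInt W).sign else 1 := by
  set d : ℤ := NumberField.discr K with hd_def
  have hd0 : d ≠ 0 := NumberField.discr_ne_zero K
  have h8 : d % 8 = 1 := discr_emod_eight_of_two K h2 hH2
  have hodd : Odd d := Int.odd_iff.mpr (by omega)
  split_ifs with hneg
  · have hK : IsImaginaryQuadratic K :=
      ⟨h2, NumberField.nrRealPlaces_eq_zero_iff.mp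
        (Literature.NumberTheory.QuadraticFields.Quadratic.nrRealPlaces_eq_zero_and_nrComplexPlaces_eq_one h2 hneg).1⟩
    exact GenusKolyTwin.jacobiSym_minimalDiscriminantInt_natAbs_discr W hK hodd hHN
  · have hpos : 0 < d := lt_of_le_of_ne (not_lt.mp hneg) (Ne.symm hd0)
    have hdabs : (d.natAbs : ℤ) = d := Int.natAbs_of_nonneg hpos.le
    refine jacobiSym_eq_one_of_mod_eight_eq_one (by omega) (minimalDiscriminantInt_ne_zero W) fun p hp hp2 hpΔ ↦ ?_
    rw [hdabs]
    exact Literature.SatisfiesHeegnerHypothesis.jacobiSym_discr_eq_one h2 hHN hp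
      (GenusKolyTwin.dvd_conductorNorm_of_dvd_minimalDiscriminantInt W hp hpΔ) hp2

omit [W.IsGloballyMinimal] in
/-- `#Sel₂(V) = 2^s` for every elliptic `V/ℚ` (a finite group killed by `2`). [cite: SilvermanAEC2009, Thm X.4.2(b)] -/
theorem exists_natCard_selmerGroup_two_eq_pow (V : WeierstrassCurve ℚ) [V.IsElliptic] :
    ∃ s : ℕ, Nat.card (V.selmerGroup ((2 : ℕ) : ℤ)) = 2 ^ s := by
  haveI : Finite (V.selmerGroup ((2 : ℕ) : ℤ)) := V.finite_selmerGroup_holds (by norm_num)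
  haveI : Fact (Nat.Prime 2) := ⟨Nat.prime_two⟩
  refine exists_natCard_eq_pow_of_nsmul_eq_zero (G := V.selmerGroup ((2 : ℕ) : ℤ)) 2 fun z ↦ Subtype.ext ?_
  change (2 : ℕ) • (z : galH1Torsion V ((2 : ℕ) : ℤ)) = 0
  rw [← natCast_zsmul]
  exact zsmul_discreteH1_torsion ((2 : ℕ) : ℤ) (z : galH1Torsion V ((2 : ℕ) : ℤ))

/-- **`d₂(W) + d₂(W^{(d_K)}) ≡ [d_K < 0] (mod 2)`** — Kramer's congruence for the twist by the discriminant of a quadratic field in which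
`2` and every prime of `N_W` split, with ALL local indices evaluated: `Σ_v δ_v = [Δ > 0 ∧ d_K < 0] + Σ_{q ∣ d_K} i_q ≡ [d_K < 0]`, since
`(−1)^{Σ i_q} = J(Δ_min | |d_K|) = (sign Δ_min)^{[d_K<0]}` (Monsky 1996, §2; Kramer 1981 Cor. 1). Any model `Wd` of the twist.
[cite: Monsky1996, Lemma 1.4(b) and §2] [cite: Kramer1981, Thm. 1 and Cor. 1] [cite: MazurRubin2010, Thm. 2.7] -/
theorem card_selmerGroup_add_twist_mod_two (h2 : Module.finrank ℚ K = 2) (hH2 : SatisfiesHeegnerHypothesis 2 K)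
    (hHN : SatisfiesHeegnerHypothesis (W.conductorNorm ℤ) K)
    {Wd : WeierstrassCurve ℚ} [Wd.IsElliptic] {C : VariableChange ℚ} (hWd : C • W.quadraticTwist (NumberField.discr K : ℚ) = Wd) :
    ∃ s s' : ℕ, Nat.card (W.selmerGroup ((2 : ℕ) : ℤ)) = 2 ^ s ∧ Nat.card (Wd.selmerGroup ((2 : ℕ) : ℤ)) = 2 ^ s' ∧
      (s + s') % 2 = if NumberField.discr K < 0 then 1 else 0 := by
  set d : ℤ := NumberField.discr K with hd_def
  obtain ⟨s, hs⟩ := exists_natCard_selmerGroup_two_eq_pow W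
  obtain ⟨s', hs'⟩ := exists_natCard_selmerGroup_two_eq_pow Wd
  obtain ⟨B, hB, hJ⟩ := exists_prod_card_roots_add_one_eq_two_pow W K h2 hH2 hHN
  refine ⟨s, s', hs, hs', ?_⟩
  have hsq := isSquare_card_selmerGroup_mul_twist_mul_localIndices W K h2 hH2 hHN hWd
  rw [hs, hs', hB] at hsq
  -- the archimedean bit
  set e : ℕ := if 0 < W.Δ ∧ d < 0 then 1 else 0 with he
  have he2 : (if 0 < W.Δ ∧ d < 0 then 2 else 1 : ℕ) = 2 ^ e := by
    rw [he]; split_ifs <;> rfl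
  rw [he2, ← pow_add, ← pow_add, ← pow_add] at hsq
  -- a square power of two has even exponent
  have heven : (s' + s + (e + B)) % 2 = 0 := by
    by_contra hodd
    exact not_isSquare_two_pow_of_mod_two_eq_one (by omega) hsq
  -- the sign of the genus budget: `(−1)^B = J(Δ_min | |d_K|) = (sign Δ_min)^{[d<0]}`
  rw [jacobiSym_minimalDiscriminantInt_natAbs_discr_eq W K h2 hH2 hHN] at hJ
  have hΔ0 : W.Δ ≠ 0 := W.isUnit_Δ.ne_zero
  -- comparing parities through powers of `-1` (cf. `PairingGenus.mod_two_eq_of_neg_one_pow_eq`)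
  have hcmp : ∀ {n m : ℕ}, (-1 : ℤ) ^ n = (-1) ^ m → n % 2 = m % 2 := fun {n m} h ↦ by
    rcases Nat.even_or_odd n with hn | hn <;> rcases Nat.even_or_odd m with hm | hm
    · rw [Nat.even_iff.mp hn, Nat.even_iff.mp hm]
    · rw [hn.neg_one_pow, hm.neg_one_pow] at h; norm_num at h
    · rw [hn.neg_one_pow, hm.neg_one_pow] at h; norm_num at h
    · rw [Nat.odd_iff.mp hn, Nat.odd_iff.mp hm]
  have hB2 : B % 2 = (if W.Δ < 0 ∧ d < 0 then 1 else 0 : ℕ) % 2 := by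
    apply hcmp
    rw [hJ]
    by_cases hdneg : d < 0
    · rw [if_pos hdneg]
      rcases lt_or_gt_of_ne hΔ0 with hΔ | hΔ
      · rw [if_pos ⟨hΔ, hdneg⟩, pow_one, (GenusKolyTwin.sign_minimalDiscriminantInt_eq_neg_one_iff W).mpr hΔ]
      · rw [if_neg (fun h ↦ (lt_asymm h.1 hΔ).elim), pow_zero, Int.sign_eq_one_iff_pos.mpr]
        rw [← @Int.cast_pos ℚ, cast_minimalDiscriminantInt]
        exact hΔ
    · rw [if_neg hdneg, if_neg (fun h ↦ hdneg h.2), pow_zero]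
  -- bookkeeping
  by_cases hdneg : d < 0
  · rw [if_pos hdneg]
    rcases lt_or_gt_of_ne hΔ0 with hΔ | hΔ
    · have he0 : e = 0 := by rw [he, if_neg (fun h ↦ (lt_asymm h.1 hΔ).elim)]
      rw [if_pos ⟨hΔ, hdneg⟩] at hB2
      omega
    · have he1 : e = 1 := by rw [he, if_pos ⟨hΔ, hdneg⟩]
      rw [if_neg (fun h ↦ (lt_asymm h.1 hΔ).elim)] at hB2
      omega
  · rw [if_neg hdneg]
    rw [if_neg (fun h ↦ hdneg h.2)] at hB2
    have he0 : e = 0 := by rw [he, if_neg (fun h ↦ hdneg h.2)]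
    omega

end Parity

end Summit.BirchSwinnertonDyer.BirchSwinnertonDyer.Theorems.GenusKolyArch

end
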